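import Summits.ResolutionOfSingularities.ResolutionOfSingularities.Theorems.FrobeniusLadderFInjectiveMacaulayficationFiClauseOfRegular
import Summits.ResolutionOfSingularities.ResolutionOfSingularities.Theorems.FrobeniusLadderFInjectiveMacaulayficationPointFixableTransport
import Summits.ResolutionOfSingularities.ResolutionOfSingularities.Theorems.FrobeniusLadderFInjectiveMacaulayficationTameWildSplit
import Literature.AlgebraicGeometry.CossartPiltant200819.GoodResolutionOneBlowupQuasiExcellent2019
import Literature.AlgebraicGeometry.Resolution.BlowupAlgebraPrimesPoints
import Literature.AlgebraicGeometry.Resolution.GenericPointStalkData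
import Literature.AlgebraicGeometry.Resolution.BlowupsFlatBaseChange
import Literature.AlgebraicGeometry.Resolution.QuasiExcellentSchemes
import Literature.AlgebraicGeometry.Resolution.ExcellentRingsFieldProofs
import Literature.AlgebraicGeometry.Resolution.Temkin2008OfHironaka
import Literature.AlgebraicGeometry.Resolution.GeneralLU
import Literature.AlgebraicGeometry.Resolution.GeneralLUProofs
import Mathlib.AlgebraicGeometry.FunctionField
import Mathlib.AlgebraicGeometry.Noetherian
import HarnessLib

/-!
# POINT-FIX AT A BAD POINT OF LOCAL DIMENSION 3 WITH REGULAR PROPER GENERIZATIONS (door v30 rung (T1-reg) at `dim 𝒪 = 3`;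
# the level-3 one-stratum core «regular blow-up centre of a quasi-excellent local threefold» read at the local ring)
# (crux `FInjectiveMacaulayfication` stmt-ResolutionOfSingularities-15315, chain w45a; res-L1-w45a-plan-1 R15.18 (3)(a):
# «stub-3 := the door's RUNG `PointFixAtNonClosedOfRegular` at dim 𝒪_η = 3 (Z = Spec 𝒪_{X₁,η}; chart–stalk dictionary ⇒ `PointFixData`)»;
# typed target = res-L1-w45a-strat-1 `FC2Dim4Sig.lean` v0.3 §2 `PointFixAtNonClosedOfRegular`; seat res-L1-w45a-stub-3)

[OURS · L1 W4.5a] Support file (`--supports stmt-ResolutionOfSingularities-15315 --as helper`); NOT a statement of any manuscript; AI-written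
(AI review is weaker than expert review). CONDITIONAL on the three named facts of the tree's threefold package, taken BY NAME as hypotheses:
`CossartPiltant2019General`, `Stacks081R`, `CossartPiltant2019Principalization` (exactly as in `ClosedCentreDimEq3` / `FCUnguardedDimEq3`);
the quasi-excellence inputs `Stacks07QW_field` / `Stacks07QU` are the tree's THEOREMS `Stacks07QW_field_holds` / `Stacks07QU_holds`.

THE STATEMENT (`pfix_of_isRegularLocalRing_generizations`). `X₁` an integral scheme locally of finite type over a field `k` of
characteristic `p`, `x ∈ X₁` a point with `dim 𝒪_{X₁,x} = 3` whose local ring is NOT regular but all of whose proper generizations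
`y ⤳ x`, `y ≠ x` have regular local rings. Then `𝒪_{X₁,x}` is POINT-FIXABLE (`PFix`, the chain's currency of `PointFixableTransport` /
`TameWildSplit.PFixData` — the conclusion is stated with that tree abbreviation — / strat-1's `PointFixData`): there are `c₁, …, c_n ∈ 𝒪_{X₁,x}` with `(c) ≠ 0`, `√(c) = 𝔪_x`, such that every
prime `𝔔` of every affine blow-up algebra `𝒪_{X₁,x}[(c)/c_j]` lying over `𝔪_x` has a localisation that is a domain, Cohen–Macaulay and with
all parameter ideals Frobenius closed (indeed regular).

PROOF. `Z := Spec 𝒪_{X₁,x}` is an integral Noetherian separated quasi-excellent scheme of dimension `3` (`𝒪_{X₁,x}` is a localisation of a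
finite-type `k`-algebra: `Scheme.isQuasiExcellent_of_locallyOfFiniteType` + `isQuasiExcellentRing_stalk` + `…_of_isQuasiExcellentRing`).
Cossart–Piltant (`CP2019.exists_isBlowup_isRegular_of_dim_three_of_isQuasiExcellent`): a blowing up `ρ : T → Z` along `𝓛 ≠ ⊥` with `T`
regular and `Supp 𝓛 ⊆ Sing Z`. Every non-closed point of `Z` is the image of a proper generization of `x` with the same local ring
(`Spec 𝒪_{X₁,x} → X₁` induces isomorphisms on local rings), hence regular: `Supp 𝓛 ⊆ {𝔪_x}`; and `𝔪_x ∈ Supp 𝓛`, for otherwise `ρ` is an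
isomorphism near `𝔪_x` and `𝒪_{X₁,x}` would be regular. So `√(𝓛_{𝔪_x}) = 𝔪` (`radical_stalkIdeal_eq_maximalIdeal_of_mem_maxPoints`); with
generators `c` of `𝓛_{𝔪_x}`, every prime of `𝒪[(c)/c_j]` over `𝔪` is the local ring of a point of `T` (chart–stalk dictionary
`IsBlowup.exists_point_of_blowupAlgebra_prime`), hence regular, hence FULL (`FiClauseOfRegular.stub_fiClauseOfRegular`); finally transport
from `𝒪_{Z,𝔪} ≅ 𝒪_{X₁,x}` (`stalkClosedPointIso`, `PointFixableTransport.pointFixable_of_ringEquiv`).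

COROLLARY `pointFixAtNonClosedOfRegular_dimThree`: the hypotheses of strat-1's `PointFixAtNonClosedOfRegular` with `ringKrullDim 𝒪_η = 3`
(non-closed `η`, `¬ FCl` at `η` ⇒ `𝒪_η` not regular) give `PointFixData p X₁ η n′ c′` in its expanded form (LocFix datum ∧ `√(c′) = 𝔪_η`).
The cases `dim 𝒪_η ≤ 2` of that rung (normalisation / Lipman) are not treated here.
[folklore assembly; cite: CossartPiltant2019, Thm. 1.1; StacksProject, Tag 0804 and Tag 0805]
-/

-- single-problem summit: the doubled namespace component is forced
set_option linter.dupNamespace false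

noncomputable section

open AlgebraicGeometry CategoryTheory Literature.AlgebraicGeometry.Resolution TopologicalSpace IsLocalRing
open Literature.AlgebraicGeometry.CossartPiltant200819

namespace Summit.ResolutionOfSingularities.ResolutionOfSingularities.Theorems.FInjectiveMacaulayfication.PointFixOfRegularGenerizations

open Summit.ResolutionOfSingularities.ResolutionOfSingularities.Theorems.FInjectiveMacaulayfication

/-! ## §1 The local scheme `Spec 𝒪_{X₁,x}` -/

/-- `Spec 𝒪_{X,x}` is quasi-excellent for `X` locally of finite type over a field (`𝒪_{X,x}` is a localisation of a finite-type
`k`-algebra; Stacks 07QW + 07QU, both PROVED in the tree). [folklore; cite: StacksProject, Tag 07QW and Tag 07QU] -/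
theorem isQuasiExcellent_Spec_stalk {k : Type} [Field k] {X : Scheme.{0}} (f : X ⟶ Spec (.of k)) [LocallyOfFiniteType f] (x : X) :
    Scheme.IsQuasiExcellent (Spec (X.presheaf.stalk x)) := by
  have hX : Scheme.IsQuasiExcellent X := Scheme.isQuasiExcellent_of_locallyOfFiniteType Stacks07QW_field_holds f
  have hR : IsQuasiExcellentRing (X.presheaf.stalk x) := hX.isQuasiExcellentRing_stalk x
  exact Scheme.isQuasiExcellent_of_locallyOfFiniteType_of_isQuasiExcellentRing Stacks07QU_holds hR (𝟙 (Spec (X.presheaf.stalk x)))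

/-- A non-closed point of `Spec 𝒪_{X,x}` maps to a PROPER generization of `x` under `Spec 𝒪_{X,x} → X`, and the local rings agree; so if the
proper generizations of `x` are regular, every point of `Spec 𝒪_{X,x}` other than the closed point is a regular point. [folklore;
cite: StacksProject, Tag 01J7] -/
theorem mem_regularLocus_Spec_stalk_of_ne_closedPoint {X : Scheme.{0}} (x : X)
    (hreg : ∀ y : X, y ⤳ x → y ≠ x → IsRegularLocalRing (X.presheaf.stalk y))
    (q : ↥(Spec (X.presheaf.stalk x))) (hq : q ≠ closedPoint (X.presheaf.stalk x)) :
    q ∈ Scheme.regularLocus (Spec (X.presheaf.stalk x)) := by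
  set y : X := (X.fromSpecStalk x).base q with hy
  have hyx : y ⤳ x := by
    have : y ∈ Set.range (X.fromSpecStalk x).base := ⟨q, rfl⟩
    rw [Scheme.range_fromSpecStalk] at this
    exact this
  have hne : y ≠ x := by
    intro h
    apply hq
    apply (X.fromSpecStalk x).isEmbedding.injective
    rw [Scheme.fromSpecStalk_closedPoint]
    exact h
  have hy' : y ∈ Scheme.regularLocus X := hreg y hyx hne
  haveI := flat_fromSpecStalk X x
  exact (mem_regularLocus_iff_of_flat_of_isPreimmersion (X.fromSpecStalk x) q).mpr hy'

/-! ## §2 The point-fix datum -/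

/-- **Chart–stalk dictionary, read from a REGULAR blowing up**: if `ρ : T → Z` is a blowing up along `𝓛` with `T` regular and
`s` is a maximal point of `Supp 𝓛` whose local ring has positive dimension, then `𝒪_{Z,s}` is point-fixable — generators `c` of
`𝓛_s` have `√(c) = 𝔪_s`, and every prime of every chart algebra `𝒪_{Z,s}[(c)/c_j]` over `𝔪_s` is the local ring of a point of `T`
(`IsBlowup.exists_point_of_blowupAlgebra_prime`), hence regular, hence FULL. The ring map `φ : k → 𝒪_{Z,s}` from a field of
characteristic `p` only fixes the characteristic of the chart rings. [folklore assembly; cite: StacksProject, Tag 0804 and Tag 0805] -/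
theorem pfixAt_stalk_of_isBlowup_of_isRegular (p : ℕ) [Fact p.Prime] {k : Type} [Field k] [CharP k p]
    {Z T : Scheme.{0}} [IsLocallyNoetherian Z] [IsIntegral Z] {𝓛 : Z.IdealSheafData} {ρ : T ⟶ Z} (hρ : IsBlowup ρ 𝓛)
    (hT : Scheme.IsRegular T) (s : Z) (hs : s ∈ maxPoints (𝓛.support : Set Z))
    (hpos : maximalIdeal (Z.presheaf.stalk s) ≠ ⊥) (φ : k →+* Z.presheaf.stalk s) :
    TameWildSplit.PFixData p (Z.presheaf.stalk s) := by
  classical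
  have hp : p.Prime := Fact.out
  obtain ⟨n, c, hc⟩ := Submodule.fg_iff_exists_fin_generating_family.mp (IsNoetherian.noetherian (stalkIdeal 𝓛 s))
  have hc' : Ideal.span (Set.range c) = stalkIdeal 𝓛 s := hc
  have hrad : (Ideal.span (Set.range c)).radical = maximalIdeal (Z.presheaf.stalk s) := by
    have h := radical_stalkIdeal_eq_maximalIdeal_of_mem_maxPoints hs
    rwa [← hc'] at h
  refine ⟨n, c, ?_, hrad, fun j 𝔔 h𝔔 => ?_⟩
  · intro h0
    rw [h0] at hrad
    exact hpos (by rw [← hrad]; exact nilradical_eq_zero _)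
  · obtain ⟨t, -, ⟨et⟩⟩ := hρ.exists_point_of_blowupAlgebra_prime s c hc' j 𝔔 h𝔔
    haveI : IsRegularLocalRing (T.presheaf.stalk t) := hT t
    haveI : IsRegularLocalRing (Localization.AtPrime 𝔔.asIdeal) := IsRegularLocalRing.of_ringEquiv et
    haveI : CharP (Localization.AtPrime 𝔔.asIdeal) p :=
      CharP.of_ringHom_of_ne_zero
        ((algebraMap (blowupAlgebra (Ideal.span (Set.range c)) (c j)) (Localization.AtPrime 𝔔.asIdeal)).comp
          ((algebraMap (Z.presheaf.stalk s) (blowupAlgebra (Ideal.span (Set.range c)) (c j))).comp φ)) p hp.ne_zero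
    exact FiClauseOfRegular.stub_fiClauseOfRegular p (Localization.AtPrime 𝔔.asIdeal)

/-- **Cossart–Piltant at the local scheme**: for `x ∈ X₁` (integral, locally of finite type over a field) with `dim 𝒪_{X₁,x} = 3`,
non-regular local ring and regular proper generizations, `Z := Spec 𝒪_{X₁,x}` admits a blowing up `ρ : T → Z` along some `𝓛` with
`T` regular and `Supp 𝓛 = {closed point}` (so the closed point is a maximal point of the support). Modulo the three named facts of
the threefold package. [folklore assembly; cite: CossartPiltant2019, Thm. 1.1] -/
theorem exists_isBlowup_isRegular_Spec_stalk
    (hG : CossartPiltant2019General.{0}) (h081R : Stacks081R.{0}) (hP : CossartPiltant2019Principalization.{0})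
    {k : Type} [Field k] {X₁ : Scheme.{0}} (f₁ : X₁ ⟶ Spec (.of k)) [LocallyOfFiniteType f₁] [IsIntegral X₁] (x : X₁)
    (hdim : ringKrullDim (X₁.presheaf.stalk x) = (3 : ℕ))
    (hreg : ∀ y : X₁, y ⤳ x → y ≠ x → IsRegularLocalRing (X₁.presheaf.stalk y))
    (hbad : ¬ IsRegularLocalRing (X₁.presheaf.stalk x)) :
    ∃ (𝓛 : (Spec (X₁.presheaf.stalk x)).IdealSheafData) (T : Scheme.{0}) (ρ : T ⟶ Spec (X₁.presheaf.stalk x)),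
      IsBlowup ρ 𝓛 ∧ Scheme.IsRegular T ∧
        closedPoint (X₁.presheaf.stalk x) ∈ maxPoints (𝓛.support : Set ↥(Spec (X₁.presheaf.stalk x))) := by
  haveI : IsLocallyNoetherian X₁ := LocallyOfFiniteType.isLocallyNoetherian f₁
  have hqe : Scheme.IsQuasiExcellent (Spec (X₁.presheaf.stalk x)) := isQuasiExcellent_Spec_stalk f₁ x
  have hdimZ : topologicalKrullDim ↥(Spec (X₁.presheaf.stalk x)) = 3 := by
    have h := PrimeSpectrum.topologicalKrullDim_eq_ringKrullDim (R := X₁.presheaf.stalk x)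
    rw [hdim] at h
    exact h
  obtain ⟨𝓛, T, ρ, -, hρ, hT, U, hU, hsupp, -⟩ :=
    CP2019.exists_isBlowup_isRegular_of_dim_three_of_isQuasiExcellent hG h081R hP hqe hdimZ
  refine ⟨𝓛, T, ρ, hρ, hT, mem_maxPoints_iff.mpr ⟨?_, fun q hq _ => ?_⟩⟩
  · have hsupp₀ : (𝓛.support : Set ↥(Spec (X₁.presheaf.stalk x))) ⊆ (Scheme.regularLocus (Spec (X₁.presheaf.stalk x)))ᶜ := by
      rw [← hU]; exact hsupp
    rw [CP2019.support_eq_compl_regularLocus_of_isBlowup_of_isRegular hρ hT hsupp₀]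
    intro hsreg
    haveI : IsRegularLocalRing ((Spec (X₁.presheaf.stalk x)).presheaf.stalk (closedPoint (X₁.presheaf.stalk x))) := hsreg
    exact hbad (IsRegularLocalRing.of_ringEquiv (stalkClosedPointIso (X₁.presheaf.stalk x)).commRingCatIsoToRingEquiv)
  · by_contra hne
    exact hsupp hq (by rw [hU]; exact mem_regularLocus_Spec_stalk_of_ne_closedPoint x hreg q hne)

/-- **`PFix` AT A NON-REGULAR POINT OF LOCAL DIMENSION 3 WITH REGULAR PROPER GENERIZATIONS**, modulo the three named facts of the
threefold package (see the module docstring for the statement and proof). [folklore assembly; cite: CossartPiltant2019, Thm. 1.1;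
StacksProject, Tag 0804 and Tag 0805] -/
theorem pfix_of_isRegularLocalRing_generizations
    (hG : CossartPiltant2019General.{0}) (h081R : Stacks081R.{0}) (hP : CossartPiltant2019Principalization.{0})
    (p : ℕ) [Fact p.Prime] {k : Type} [Field k] [CharP k p]
    {X₁ : Scheme.{0}} (f₁ : X₁ ⟶ Spec (.of k)) [LocallyOfFiniteType f₁] [IsIntegral X₁] (x : X₁)
    (hdim : ringKrullDim (X₁.presheaf.stalk x) = (3 : ℕ))
    (hreg : ∀ y : X₁, y ⤳ x → y ≠ x → IsRegularLocalRing (X₁.presheaf.stalk y))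
    (hbad : ¬ IsRegularLocalRing (X₁.presheaf.stalk x)) :
    TameWildSplit.PFixData p (X₁.presheaf.stalk x) := by
  haveI : IsLocallyNoetherian X₁ := LocallyOfFiniteType.isLocallyNoetherian f₁
  obtain ⟨𝓛, T, ρ, hρ, hT, hs⟩ := exists_isBlowup_isRegular_Spec_stalk hG h081R hP f₁ x hdim hreg hbad
  let eO : (Spec (X₁.presheaf.stalk x)).presheaf.stalk (closedPoint (X₁.presheaf.stalk x)) ≃+* X₁.presheaf.stalk x :=
    (stalkClosedPointIso (X₁.presheaf.stalk x)).commRingCatIsoToRingEquiv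
  -- `dim 𝒪 = 3 > 0`: the maximal ideal is non-zero
  have hpos : maximalIdeal ((Spec (X₁.presheaf.stalk x)).presheaf.stalk (closedPoint (X₁.presheaf.stalk x))) ≠ ⊥ := by
    intro hm
    have hF := IsLocalRing.isField_iff_maximalIdeal_eq.mpr hm
    have h0 : ringKrullDim ((Spec (X₁.presheaf.stalk x)).presheaf.stalk (closedPoint (X₁.presheaf.stalk x))) = 0 := by
      letI := hF.toField
      exact ringKrullDim_eq_zero_of_field _
    rw [ringKrullDim_eq_of_ringEquiv eO, hdim] at h0
    exact absurd h0 (by norm_num)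
  -- the ring map `k → 𝒪_{Z,s}` (characteristic bookkeeping)
  let φ : k →+* (Spec (X₁.presheaf.stalk x)).presheaf.stalk (closedPoint (X₁.presheaf.stalk x)) :=
    eO.symm.toRingHom.comp ((X₁.presheaf.germ ⊤ x trivial).hom.comp (f₁.appTop.hom.comp (Scheme.ΓSpecIso (.of k)).inv.hom))
  have hO := pfixAt_stalk_of_isBlowup_of_isRegular p hρ hT _ hs hpos φ
  exact PointFixableTransport.pointFixable_of_ringEquiv p eO hO

/-! ## §3 The door's rung (T1-reg) at `dim 𝒪_η = 3`, in strat-1's `PointFixData` shape -/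

/-- **RUNG `PointFixAtNonClosedOfRegular` AT `dim 𝒪_η = 3`** (res-L1-w45a-strat-1 `FC2Dim4Sig.lean` v0.3 §2, hypotheses verbatim with
`ringKrullDim 𝒪_η = 3` in place of `≤ 3`; conclusion = `∃ n′ c′, PointFixData p X₁ η n′ c′` with `PointFixData`/`LocFixData` unfolded and
`FullCl` from `SliceableCentre`): at a non-closed F-bad point `η` of local dimension 3 all of whose proper generizations are regular, a
PRIMARY point-fix datum exists. The F-badness of `η` is used only to know that `𝒪_η` is not regular (`FiClauseOfRegular`); separatedness,
quasi-compactness, `4 ≤ dim X₁`, the CM hypothesis and non-closedness are not used. Modulo the three threefold named facts.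
[folklore assembly; cite: CossartPiltant2019, Thm. 1.1; StacksProject, Tag 0804 and Tag 0805] -/
theorem pointFixAtNonClosedOfRegular_dimThree
    (hG : CossartPiltant2019General.{0}) (h081R : Stacks081R.{0}) (hP : CossartPiltant2019Principalization.{0}) :
    ∀ (p : ℕ), p.Prime → ∀ (k : Type) [Field k] [CharP k p]
    (X₁ : Scheme.{0}) (f₁ : X₁ ⟶ Spec (.of k)),
      IsSeparated f₁ → LocallyOfFiniteType f₁ → QuasiCompact f₁ → IsIntegral X₁ → 4 ≤ topologicalKrullDim X₁ →
      (∀ x : X₁, SliceableCentre.CMCl (X₁.presheaf.stalk x)) →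
      ∀ η : X₁, ¬ IsClosed ({η} : Set X₁) → ¬ SliceableCentre.FCl p (X₁.presheaf.stalk η) →
        ringKrullDim (X₁.presheaf.stalk η) = (3 : ℕ) →
        (∀ y : X₁, y ⤳ η → y ≠ η → IsRegularLocalRing (X₁.presheaf.stalk y)) →
        ∃ (n' : ℕ) (c' : Fin n' → X₁.presheaf.stalk η),
          (Ideal.span (Set.range c') ≠ ⊥ ∧ Ideal.span (Set.range c') ≤ maximalIdeal (X₁.presheaf.stalk η) ∧
            ∀ (j : Fin n') (𝔔 : PrimeSpectrum (blowupAlgebra (Ideal.span (Set.range c')) (c' j))),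
              𝔔.asIdeal.comap (algebraMap (X₁.presheaf.stalk η) (blowupAlgebra (Ideal.span (Set.range c')) (c' j))) =
                maximalIdeal (X₁.presheaf.stalk η) → SliceableCentre.FullCl p (Localization.AtPrime 𝔔.asIdeal)) ∧
          (Ideal.span (Set.range c')).radical = maximalIdeal (X₁.presheaf.stalk η) := by
  intro p hp k _ _ X₁ f₁ _ hft _ hint _ _ η _ hbad hdim hreg
  haveI := hft
  haveI := hint
  haveI : Fact p.Prime := ⟨hp⟩
  -- F-bad ⇒ not regular
  have hnreg : ¬ IsRegularLocalRing (X₁.presheaf.stalk η) := by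
    intro hreg'
    haveI := hreg'
    haveI : CharP (X₁.presheaf.stalk η) p :=
      CharP.of_ringHom_of_ne_zero
        ((X₁.presheaf.germ ⊤ η trivial).hom.comp (f₁.appTop.hom.comp (Scheme.ΓSpecIso (.of k)).inv.hom)) p hp.ne_zero
    exact hbad fun d hd s hs => ((FiClauseOfRegular.stub_fiClauseOfRegular p (X₁.presheaf.stalk η)).2 d hd s hs).2
  obtain ⟨n, c, hne, hrad, hcl⟩ := pfix_of_isRegularLocalRing_generizations hG h081R hP p f₁ η hdim hreg hnreg
  refine ⟨n, c, ⟨hne, ?_, fun j 𝔔 h𝔔 => hcl j 𝔔 h𝔔⟩, hrad⟩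
  rw [← hrad]
  exact Ideal.le_radical

end Summit.ResolutionOfSingularities.ResolutionOfSingularities.Theorems.FInjectiveMacaulayfication.PointFixOfRegularGenerizations

end
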